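import Mathlib.Analysis.SpecialFunctions.Gaussian.GaussianIntegral
import Mathlib.Analysis.SpecialFunctions.Gamma.Basic
import Mathlib.Analysis.SpecialFunctions.ImproperIntegrals
import Mathlib.Analysis.SpecialFunctions.Trigonometric.DerivHyp
import Mathlib.MeasureTheory.Integral.IntegralEqImproper
import HarnessLib

/-!
# The Gaussian test function of Deshouillers–Iwaniec §5.3 in Kuznetsov's formula and its Bessel transform

For the proof of the large sieve inequalities [DeshouillersIwaniec1982, Theorem 2 (1.29)–(1.30)] one
applies Kuznetsov's formula in its spectral form [Iwaniec2002, Theorem 9.3 (9.12)] with a test function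
`h = h_K` that is NONNEGATIVE on the spectrum, `≥ e⁻¹` on `|t| ≤ K`, and whose Bessel transform
`h⁺(x) = 2i ∫ J_{2it}(x) h(t) t dt/ch(πt)` [Iwaniec2002, (9.10)] is rapidly decaying.  Deshouillers–Iwaniec
(p. 260) average their rough formula (4.8) against `t sh(πt) e^{−(t/K)²}`; in the spectral form this is
the choice

  `h_K(t) = πt coth(πt) e^{−t²/K²}`   (`hGauss`),  with  `h_K(t) t th(πt) = πt² e^{−t²/K²}`,

so that `h₀ = π⁻¹∫ t th(πt) h_K(t) dt = ∫ t² e^{−t²/K²} dt = (√π/2)K³` ([Iwaniec2002, (9.9)]; `hZero`) and, by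
the Mehler–Sonine representation `(J_{2it} − J_{−2it})(x) = −(4i/π) sh(πt) ∫₀^∞ cos(x ch ξ) cos(2tξ) dξ`
[Watson1944, §6.21] (the convention of the tree's `BFI.L1.Kuz.kuzTransforms`),

  `h_K⁺(x) = (4/π) ∫₀^∞ cos(x ch ξ) g_K(ξ) dξ`,  `g_K(ξ) = π∫ t² e^{−t²/K²} cos(2tξ) dt = π√π K³ (1/2 − ξ²K²) e^{−ξ²K²}`

(Gradshteyn–Ryzhik 3.952.8); we take this `ξ`-side expression as the DEFINITION `hPlus K x` (as D–I
take (5.6)).  This file is pure real analysis: the closed forms, the partial integration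

  `h_K⁺(x) = 4√π K³ x ∫₀^∞ (ξ/2) e^{−ξ²K²} sh ξ sin(x ch ξ) dξ`   (`hPlus_eq_formB`, D–I's (5.6)↔(5.7)),

and the size estimates `∫₀^∞ (ξ/2)e^{−ξ²K²} sh ξ (1 + ch ξ) dξ ≤ C K⁻³`, `∫₀^1 |g_K| ≤ C K²`,
`∫₁^∞ |g_K| (1 + ch ξ) ≤ C K⁵ e^{−K²/2}` and their consequences `|h_K⁺(x)| ≤ C min(x, K²)`, used in
`DeshouillersIwaniecLargeSieveMaass*`.

## References
* [DeshouillersIwaniec1982] J.-M. Deshouillers, H. Iwaniec, *Kloosterman sums and Fourier coefficients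
  of cusp forms*, Invent. Math. 70 (1982): §5.3 pp. 260–261, (5.6)–(5.7).
* [Iwaniec2002] H. Iwaniec, *Spectral methods of automorphic forms*, 2nd ed., GSM 53: Theorem 9.3,
  (9.9)–(9.12); (8.5)–(8.6).
* [Watson1944] G. N. Watson, *A treatise on the theory of Bessel functions*: §6.21.
-/

noncomputable section

open Real MeasureTheory Set Filter
open scoped Topology

namespace Literature.NumberTheory.Sieve

namespace DeshouillersIwaniec

/-! ### The test function and the Gaussian kernels -/

/-- The spectral test function `h_K(t) = πt coth(πt) e^{−t²/K²}` (value `1` at `t = 0` by continuity).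
[cite: DeshouillersIwaniec1982, §5.3 p. 260; Iwaniec2002, Theorem 9.3] -/
def hGauss (K t : ℝ) : ℝ := (if t = 0 then 1 else π * t * Real.cosh (π * t) / Real.sinh (π * t)) * Real.exp (-(t ^ 2 / K ^ 2))

/-- Its value on the exceptional spectrum `t = iy`: `h_K(iy) = πy cot(πy) e^{y²/K²}` (`0 < y < 1/2`).
[cite: DeshouillersIwaniec1982, §5.3 p. 260; Iwaniec2002, Theorem 9.3] -/
def hGaussExc (K y : ℝ) : ℝ := π * y * Real.cos (π * y) / Real.sin (π * y) * Real.exp (y ^ 2 / K ^ 2)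

/-- The diagonal weight `h₀ = π⁻¹ ∫ t th(πt) h_K(t) dt = ∫ t² e^{−t²/K²} dt = (√π/2) K³`.
[cite: Iwaniec2002, (9.9)] -/
def hZero (K : ℝ) : ℝ := Real.sqrt π / 2 * K ^ 3

/-- `γ_K(ξ) = (ξ/2) e^{−ξ²K²}`, the primitive of `(1/2 − ξ²K²)e^{−ξ²K²}` vanishing at `0`. [folklore] -/
def gamK (K ξ : ℝ) : ℝ := ξ / 2 * Real.exp (-(ξ ^ 2 * K ^ 2))

/-- `g_K(ξ) = π√π K³ (1/2 − ξ²K²) e^{−ξ²K²} = π ∫ t² e^{−t²/K²} cos(2tξ) dt`, the cosine transform of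
`h_K(t) t th(πt)`. [cite: Iwaniec2002, (9.10); DeshouillersIwaniec1982, §5.3 p. 260] -/
def gGauss (K ξ : ℝ) : ℝ := π * Real.sqrt π * K ^ 3 * ((1 / 2 - ξ ^ 2 * K ^ 2) * Real.exp (-(ξ ^ 2 * K ^ 2)))

/-- **The Bessel transform `h_K⁺`** of the test function, in its Mehler–Sonine form
`h⁺(x) = (4/π) ∫₀^∞ cos(x ch ξ) g_K(ξ) dξ` (= `2i ∫ J_{2it}(x) h_K(t) t dt/ch(πt)`, [Iwaniec2002, (9.10)]).
[cite: Iwaniec2002, (9.10); Watson1944, §6.21; DeshouillersIwaniec1982, (5.7)] -/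
def hPlus (K x : ℝ) : ℝ := 4 / π * ∫ ξ in Ioi (0 : ℝ), Real.cos (x * Real.cosh ξ) * gGauss K ξ

/-! ### Elementary inequalities for `ch`, `sh` and the Gaussian -/

/-- `ch ξ ≤ e^ξ` for `ξ ≥ 0`. [folklore] -/
theorem cosh_le_exp {ξ : ℝ} (hξ : 0 ≤ ξ) : Real.cosh ξ ≤ Real.exp ξ := by
  rw [Real.cosh_eq]
  have : Real.exp (-ξ) ≤ Real.exp ξ := Real.exp_le_exp.2 (by linarith)
  linarith

/-- `0 ≤ sh ξ ≤ ξ ch ξ` for `ξ ≥ 0` (mean value: `sh' = ch` is increasing). [folklore] -/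
theorem sinh_le_mul_cosh {ξ : ℝ} (hξ : 0 ≤ ξ) : Real.sinh ξ ≤ ξ * Real.cosh ξ := by
  -- `f(ξ) = ξ ch ξ − sh ξ` has `f' = ξ sh ξ ≥ 0` and `f(0) = 0`
  have hderiv : ∀ x : ℝ, HasDerivAt (fun x => x * Real.cosh x - Real.sinh x) (x * Real.sinh x) x := by
    intro x
    have h := ((hasDerivAt_id x).mul (Real.hasDerivAt_cosh x)).sub (Real.hasDerivAt_sinh x)
    refine h.congr_deriv ?_
    simp only [id]
    ring
  have hmono : MonotoneOn (fun x => x * Real.cosh x - Real.sinh x) (Ici 0) := by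
    refine monotoneOn_of_hasDerivWithinAt_nonneg (convex_Ici 0) ?_ (fun x _ => (hderiv x).hasDerivWithinAt) ?_
    · exact (continuous_id.mul Real.continuous_cosh).sub Real.continuous_sinh |>.continuousOn
    · intro x hx
      rw [interior_Ici] at hx
      exact mul_nonneg hx.le (Real.sinh_nonneg_iff.2 hx.le)
  have key : (0 : ℝ) * Real.cosh 0 - Real.sinh 0 ≤ ξ * Real.cosh ξ - Real.sinh ξ := hmono self_mem_Ici hξ hξ
  rw [Real.cosh_zero, Real.sinh_zero] at key
  linarith

/-- `sh ξ ≤ ξ e^ξ` for `ξ ≥ 0`. [folklore] -/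
theorem sinh_le_mul_exp {ξ : ℝ} (hξ : 0 ≤ ξ) : Real.sinh ξ ≤ ξ * Real.exp ξ :=
  (sinh_le_mul_cosh hξ).trans (mul_le_mul_of_nonneg_left (cosh_le_exp hξ) hξ)

/-- The Gaussian under an exponential: `e^{−ξ²K²} ≤ e^{9/4} e^{−3Kξ}` (`(ξK − 3/2)² ≥ 0`). [folklore] -/
theorem exp_neg_sq_le (K ξ : ℝ) : Real.exp (-(ξ ^ 2 * K ^ 2)) ≤ Real.exp (9 / 4) * Real.exp (-(3 * K * ξ)) := by
  rw [← Real.exp_add]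
  exact Real.exp_le_exp.2 (by nlinarith [sq_nonneg (ξ * K - 3 / 2)])

/-- `∫₀^∞ ξ^j e^{−aξ} dξ = j!/a^{j+1}` (`a > 0`). [folklore] -/
theorem integral_pow_mul_exp_neg_mul {a : ℝ} (ha : 0 < a) (j : ℕ) :
    ∫ ξ in Ioi (0 : ℝ), ξ ^ j * Real.exp (-(a * ξ)) = (j.factorial : ℝ) / a ^ (j + 1) := by
  have h := Real.integral_rpow_mul_exp_neg_mul_Ioi (a := (j : ℝ) + 1) (r := a) (by positivity) ha
  simp only [add_sub_cancel_right, Real.rpow_natCast] at h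
  rw [Real.Gamma_nat_eq_factorial] at h
  rw [h, show ((j : ℝ) + 1) = ((j + 1 : ℕ) : ℝ) by push_cast; ring, Real.rpow_natCast, one_div, inv_pow]
  ring

/-- Integrability of `ξ^j e^{−aξ}` on `(0, ∞)` (`a > 0`). [folklore] -/
theorem integrableOn_pow_mul_exp_neg_mul {a : ℝ} (ha : 0 < a) (j : ℕ) :
    IntegrableOn (fun ξ : ℝ => ξ ^ j * Real.exp (-(a * ξ))) (Ioi 0) := by
  have h2 := integrableOn_rpow_mul_exp_neg_mul_rpow (p := 1) (s := (j : ℝ)) (b := a) (by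
    have : (0 : ℝ) ≤ j := Nat.cast_nonneg _; linarith) le_rfl ha
  refine (h2.congr_fun (fun ξ _ => ?_) measurableSet_Ioi)
  simp only [Real.rpow_natCast, Real.rpow_one, neg_mul]

/-! ### Bounds for the kernels -/

/-- `0 ≤ γ_K`. [folklore] -/
theorem gamK_nonneg (K : ℝ) {ξ : ℝ} (hξ : 0 ≤ ξ) : 0 ≤ gamK K ξ := by unfold gamK; positivity

/-- `γ_K(ξ) sh ξ (1 + ch ξ) ≤ e^{9/4} ξ² e^{−(3K−2)ξ}` for `ξ ≥ 0`. [folklore] -/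
theorem gamK_sinh_le (K : ℝ) {ξ : ℝ} (hξ : 0 ≤ ξ) :
    gamK K ξ * Real.sinh ξ * (1 + Real.cosh ξ) ≤ Real.exp (9 / 4) * (ξ ^ 2 * Real.exp (-((3 * K - 2) * ξ))) := by
  have hsh := sinh_le_mul_cosh hξ
  have hsh0 : 0 ≤ Real.sinh ξ := Real.sinh_nonneg_iff.2 hξ
  have hch := cosh_le_exp hξ
  have hch1 : 1 ≤ Real.cosh ξ := Real.one_le_cosh ξ
  have hG := exp_neg_sq_le K ξ
  have hexp : Real.exp (-(3 * K * ξ)) * Real.exp ξ * Real.exp ξ = Real.exp (-((3 * K - 2) * ξ)) := by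
    rw [← Real.exp_add, ← Real.exp_add]; ring_nf
  -- `sh ξ (1 + ch ξ) ≤ ξ ch ξ · 2 ch ξ ≤ 2 ξ e^{2ξ}`
  calc gamK K ξ * Real.sinh ξ * (1 + Real.cosh ξ)
      ≤ gamK K ξ * (ξ * Real.cosh ξ) * (2 * Real.cosh ξ) := by
        have := gamK_nonneg K hξ
        gcongr
        linarith
    _ = ξ ^ 2 * Real.exp (-(ξ ^ 2 * K ^ 2)) * (Real.cosh ξ * Real.cosh ξ) := by unfold gamK; ring
    _ ≤ ξ ^ 2 * (Real.exp (9 / 4) * Real.exp (-(3 * K * ξ))) * (Real.exp ξ * Real.exp ξ) := by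
        gcongr
    _ = Real.exp (9 / 4) * (ξ ^ 2 * Real.exp (-((3 * K - 2) * ξ))) := by rw [← hexp]; ring

/-- **`∫₀^∞ γ_K(ξ) sh ξ (1 + ch ξ) dξ ≤ 2e^{9/4}/K³`** (`K ≥ 1`; this is the `K⁻³` that makes (5.6)
useful, [DeshouillersIwaniec1982, p. 260: "(5.6) yields `Φ ≪ 1`"]). [cite: DeshouillersIwaniec1982, §5.3 p. 260] -/
theorem integral_gamK_sinh_le {K : ℝ} (hGauss : 1 ≤ K) :
    IntegrableOn (fun ξ => gamK K ξ * Real.sinh ξ * (1 + Real.cosh ξ)) (Ioi 0) ∧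
      ∫ ξ in Ioi (0 : ℝ), gamK K ξ * Real.sinh ξ * (1 + Real.cosh ξ) ≤ 2 * Real.exp (9 / 4) / K ^ 3 := by
  have ha : 0 < 3 * K - 2 := by linarith
  have hmaj := integrableOn_pow_mul_exp_neg_mul ha 2
  have hcont : Continuous fun ξ => gamK K ξ * Real.sinh ξ * (1 + Real.cosh ξ) := by
    unfold gamK; fun_prop
  have hnn : ∀ ξ ∈ Ioi (0 : ℝ), 0 ≤ gamK K ξ * Real.sinh ξ * (1 + Real.cosh ξ) := fun ξ hξ =>
    mul_nonneg (mul_nonneg (gamK_nonneg K (le_of_lt hξ)) (Real.sinh_nonneg_iff.2 (le_of_lt hξ)))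
      (by have := Real.cosh_pos ξ; linarith)
  have hle : ∀ ξ ∈ Ioi (0 : ℝ), ‖gamK K ξ * Real.sinh ξ * (1 + Real.cosh ξ)‖ ≤
      Real.exp (9 / 4) * (ξ ^ 2 * Real.exp (-((3 * K - 2) * ξ))) := fun ξ hξ => by
    rw [Real.norm_of_nonneg (hnn ξ hξ)]; exact gamK_sinh_le K (le_of_lt hξ)
  have hint : IntegrableOn (fun ξ => gamK K ξ * Real.sinh ξ * (1 + Real.cosh ξ)) (Ioi 0) :=
    Integrable.mono' (hmaj.const_mul _) hcont.aestronglyMeasurable ((ae_restrict_iff' measurableSet_Ioi).2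
      (Eventually.of_forall hle))
  refine ⟨hint, ?_⟩
  calc ∫ ξ in Ioi (0 : ℝ), gamK K ξ * Real.sinh ξ * (1 + Real.cosh ξ)
      ≤ ∫ ξ in Ioi (0 : ℝ), Real.exp (9 / 4) * (ξ ^ 2 * Real.exp (-((3 * K - 2) * ξ))) := by
        refine setIntegral_mono_on hint (hmaj.const_mul _) measurableSet_Ioi fun ξ hξ => ?_
        exact (le_abs_self _).trans (by simpa [Real.norm_eq_abs] using hle ξ hξ)
    _ = Real.exp (9 / 4) * ((2 : ℕ).factorial / (3 * K - 2) ^ (2 + 1)) := by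
        rw [integral_const_mul, integral_pow_mul_exp_neg_mul ha 2]
    _ ≤ 2 * Real.exp (9 / 4) / K ^ 3 := by
        have hK3 : K ^ 3 ≤ (3 * K - 2) ^ 3 := by
          apply pow_le_pow_left₀ (by linarith) (by linarith)
        have hK0 : 0 < K ^ 3 := by positivity
        rw [Nat.factorial_two]
        push_cast
        calc Real.exp (9 / 4) * (2 / (3 * K - 2) ^ 3) = 2 * Real.exp (9 / 4) / (3 * K - 2) ^ 3 := by ring
          _ ≤ 2 * Real.exp (9 / 4) / K ^ 3 := div_le_div_of_nonneg_left (by positivity) hK0 hK3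

/-- `|g_K(ξ)| ≤ π√π K³ (1/2 + ξ²K²) e^{−ξ²K²}`. [folklore] -/
theorem abs_gGauss_le (K ξ : ℝ) (hGauss : 0 ≤ K) :
    |gGauss K ξ| ≤ π * Real.sqrt π * K ^ 3 * ((1 / 2 + ξ ^ 2 * K ^ 2) * Real.exp (-(ξ ^ 2 * K ^ 2))) := by
  unfold gGauss
  rw [abs_mul, abs_of_nonneg (by positivity : 0 ≤ π * Real.sqrt π * K ^ 3), abs_mul, abs_of_nonneg (Real.exp_pos _).le]
  gcongr
  rw [abs_le]; constructor <;> nlinarith [sq_nonneg (ξ * K)]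

/-- **`∫₀^∞ |g_K| ≤ 3 e^{9/4} π√π K²`** (`K ≥ 1`; D–I: "(5.7) yields `Φ ≪ x⁻¹K²`").
[cite: DeshouillersIwaniec1982, §5.3 p. 260] -/
theorem integral_abs_gGauss_le {K : ℝ} (hGauss : 1 ≤ K) :
    Integrable (gGauss K) (volume.restrict (Ioi 0)) ∧
      ∫ ξ in Ioi (0 : ℝ), |gGauss K ξ| ≤ 3 * Real.exp (9 / 4) * (π * Real.sqrt π) * K ^ 2 := by
  have hK0 : 0 < K := by linarith
  have ha : 0 < 3 * K := by linarith
  have hm0 := integrableOn_pow_mul_exp_neg_mul ha 0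
  have hm2 := integrableOn_pow_mul_exp_neg_mul ha 2
  set M : ℝ → ℝ := fun ξ => π * Real.sqrt π * K ^ 3 * Real.exp (9 / 4) *
    (1 / 2 * (ξ ^ 0 * Real.exp (-(3 * K * ξ))) + K ^ 2 * (ξ ^ 2 * Real.exp (-(3 * K * ξ)))) with hM
  have hMint : IntegrableOn M (Ioi 0) := ((hm0.const_mul _).add (hm2.const_mul _)).const_mul _
  have hle : ∀ ξ ∈ Ioi (0 : ℝ), ‖gGauss K ξ‖ ≤ M ξ := by
    intro ξ _
    rw [Real.norm_eq_abs]
    refine (abs_gGauss_le K ξ hK0.le).trans ?_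
    have hG := exp_neg_sq_le K ξ
    simp only [hM, pow_zero, one_mul]
    have h1 : 0 ≤ π * Real.sqrt π * K ^ 3 := by positivity
    have h2 : 0 ≤ 1 / 2 + ξ ^ 2 * K ^ 2 := by positivity
    calc π * Real.sqrt π * K ^ 3 * ((1 / 2 + ξ ^ 2 * K ^ 2) * Real.exp (-(ξ ^ 2 * K ^ 2)))
        ≤ π * Real.sqrt π * K ^ 3 * ((1 / 2 + ξ ^ 2 * K ^ 2) * (Real.exp (9 / 4) * Real.exp (-(3 * K * ξ)))) := by
          gcongr
      _ = _ := by ring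
  have hcont : Continuous (gGauss K) := by unfold gGauss; fun_prop
  have hint : IntegrableOn (gGauss K) (Ioi 0) :=
    Integrable.mono' hMint hcont.aestronglyMeasurable ((ae_restrict_iff' measurableSet_Ioi).2 (Eventually.of_forall hle))
  refine ⟨hint, ?_⟩
  calc ∫ ξ in Ioi (0 : ℝ), |gGauss K ξ| ≤ ∫ ξ in Ioi (0 : ℝ), M ξ := by
        refine setIntegral_mono_on hint.abs hMint measurableSet_Ioi fun ξ hξ => ?_
        simpa [Real.norm_eq_abs] using hle ξ hξ
    _ = π * Real.sqrt π * K ^ 3 * Real.exp (9 / 4) * (1 / 2 * ((0 : ℕ).factorial / (3 * K) ^ (0 + 1)) +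
          K ^ 2 * ((2 : ℕ).factorial / (3 * K) ^ (2 + 1))) := by
        simp only [hM]
        rw [integral_const_mul, integral_add (hm0.const_mul _) (hm2.const_mul _), integral_const_mul, integral_const_mul,
          integral_pow_mul_exp_neg_mul ha 0, integral_pow_mul_exp_neg_mul ha 2]
    _ ≤ 3 * Real.exp (9 / 4) * (π * Real.sqrt π) * K ^ 2 := by
        simp only [Nat.factorial_zero, Nat.factorial_two, Nat.cast_one, zero_add, pow_one]
        push_cast
        have hX : 0 ≤ π * Real.sqrt π * Real.exp (9 / 4) * K ^ 2 := by positivity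
        have hid : π * Real.sqrt π * K ^ 3 * Real.exp (9 / 4) * (1 / 2 * (1 / (3 * K)) + K ^ 2 * (2 / (3 * K) ^ 3)) =
            13 / 54 * (π * Real.sqrt π * Real.exp (9 / 4) * K ^ 2) := by
          field_simp
          ring
        rw [hid]
        nlinarith [hX]

/-- The tail majorant: for `ξ ≥ 1`, `K ≥ 1`: `e^{−ξ²K²} ≤ e^{−K²/2} · e² e^{−2ξ}`. [folklore] -/
theorem exp_neg_sq_tail_le {K ξ : ℝ} (hGauss : 1 ≤ K) (hξ : 1 ≤ ξ) :
    Real.exp (-(ξ ^ 2 * K ^ 2)) ≤ Real.exp (-(K ^ 2 / 2)) * (Real.exp 2 * Real.exp (-(2 * ξ))) := by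
  rw [← Real.exp_add, ← Real.exp_add]
  apply Real.exp_le_exp.2
  -- `ξ²K² ≥ K²/2 + ξ²/2 ≥ K²/2 + 2ξ − 2`
  have h1 : K ^ 2 / 2 * 1 ≤ K ^ 2 / 2 * ξ ^ 2 := by gcongr; nlinarith
  have h2 : (1 : ℝ) / 2 * ξ ^ 2 ≤ K ^ 2 / 2 * ξ ^ 2 := by gcongr; nlinarith
  nlinarith [sq_nonneg (ξ - 2)]

/-- **The tails**: `∫₁^∞ |g_K(ξ)| (1 + ch ξ) dξ ≤ C K⁵ e^{−K²/2}` and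
`∫₁^∞ γ_K sh ξ (1 + ch ξ) ≤ C K⁰ e^{−K²/2}` with an absolute `C` (`K ≥ 1`). [folklore] -/
theorem integral_tail_le {K : ℝ} (hGauss : 1 ≤ K) :
    IntegrableOn (fun ξ => |gGauss K ξ| * (1 + Real.cosh ξ)) (Ioi 1) ∧
      ∫ ξ in Ioi (1 : ℝ), |gGauss K ξ| * (1 + Real.cosh ξ) ≤ 40 * Real.exp 2 * (π * Real.sqrt π) * K ^ 5 * Real.exp (-(K ^ 2 / 2)) := by
  have hK0 : 0 < K := by linarith
  -- majorant `π√πK³ (1/2 + ξ²K²) e^{−K²/2} e² e^{−2ξ} · 2e^{ξ} ≤ 2e² π√π K⁵ e^{−K²/2} (1 + ξ²) e^{−ξ}` on `ξ ≥ 1`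
  set C₀ : ℝ := 2 * Real.exp 2 * (π * Real.sqrt π) * K ^ 5 * Real.exp (-(K ^ 2 / 2)) with hC₀
  have hC₀0 : 0 ≤ C₀ := by positivity
  have hm0 := (integrableOn_pow_mul_exp_neg_mul one_pos 0).mono_set (Ioi_subset_Ioi (by norm_num : (0:ℝ) ≤ 1))
  have hm2 := (integrableOn_pow_mul_exp_neg_mul one_pos 2).mono_set (Ioi_subset_Ioi (by norm_num : (0:ℝ) ≤ 1))
  set M : ℝ → ℝ := fun ξ => C₀ * (ξ ^ 0 * Real.exp (-(1 * ξ)) + ξ ^ 2 * Real.exp (-(1 * ξ))) with hM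
  have hMint : IntegrableOn M (Ioi 1) := (hm0.add hm2).const_mul _
  have hle : ∀ ξ ∈ Ioi (1 : ℝ), ‖|gGauss K ξ| * (1 + Real.cosh ξ)‖ ≤ M ξ := by
    intro ξ hξ
    have hξ1 : 1 ≤ ξ := le_of_lt hξ
    have hξ0 : 0 ≤ ξ := by linarith
    rw [Real.norm_of_nonneg (by positivity)]
    have hg := abs_gGauss_le K ξ hK0.le
    have ht := exp_neg_sq_tail_le hGauss hξ1
    have hch : 1 + Real.cosh ξ ≤ 2 * Real.exp ξ := by have := cosh_le_exp hξ0; have := Real.one_le_exp hξ0; linarith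
    have hK2 : 1 / 2 + ξ ^ 2 * K ^ 2 ≤ K ^ 2 * (1 + ξ ^ 2) := by nlinarith
    have hee : Real.exp (-(2 * ξ)) * Real.exp ξ = Real.exp (-(1 * ξ)) := by rw [← Real.exp_add]; ring_nf
    show |gGauss K ξ| * (1 + Real.cosh ξ) ≤ C₀ * (ξ ^ 0 * Real.exp (-(1 * ξ)) + ξ ^ 2 * Real.exp (-(1 * ξ)))
    calc |gGauss K ξ| * (1 + Real.cosh ξ)
        ≤ (π * Real.sqrt π * K ^ 3 * ((1 / 2 + ξ ^ 2 * K ^ 2) * Real.exp (-(ξ ^ 2 * K ^ 2)))) * (2 * Real.exp ξ) :=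
          mul_le_mul hg hch (by positivity) (by positivity)
      _ ≤ (π * Real.sqrt π * K ^ 3 * ((K ^ 2 * (1 + ξ ^ 2)) * (Real.exp (-(K ^ 2 / 2)) * (Real.exp 2 * Real.exp (-(2 * ξ)))))) *
            (2 * Real.exp ξ) := by gcongr
      _ = C₀ * ((1 + ξ ^ 2) * (Real.exp (-(2 * ξ)) * Real.exp ξ)) := by rw [hC₀]; ring
      _ = C₀ * (ξ ^ 0 * Real.exp (-(1 * ξ)) + ξ ^ 2 * Real.exp (-(1 * ξ))) := by rw [hee, pow_zero]; ring
  have hcont : Continuous fun ξ => |gGauss K ξ| * (1 + Real.cosh ξ) := by unfold gGauss; fun_prop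
  have hint : IntegrableOn (fun ξ => |gGauss K ξ| * (1 + Real.cosh ξ)) (Ioi 1) :=
    Integrable.mono' hMint hcont.aestronglyMeasurable ((ae_restrict_iff' measurableSet_Ioi).2 (Eventually.of_forall hle))
  refine ⟨hint, ?_⟩
  have hint0 : ∫ ξ in Ioi (1 : ℝ), ξ ^ 0 * Real.exp (-(1 * ξ)) ≤ 1 := by
    calc ∫ ξ in Ioi (1 : ℝ), ξ ^ 0 * Real.exp (-(1 * ξ)) ≤ ∫ ξ in Ioi (0 : ℝ), ξ ^ 0 * Real.exp (-(1 * ξ)) :=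
          setIntegral_mono_set (integrableOn_pow_mul_exp_neg_mul one_pos 0)
            (Eventually.of_forall fun ξ => by positivity) (Eventually.of_forall (Ioi_subset_Ioi (by norm_num)))
      _ = 1 := by rw [integral_pow_mul_exp_neg_mul one_pos 0]; simp
  have hint2 : ∫ ξ in Ioi (1 : ℝ), ξ ^ 2 * Real.exp (-(1 * ξ)) ≤ 2 := by
    calc ∫ ξ in Ioi (1 : ℝ), ξ ^ 2 * Real.exp (-(1 * ξ)) ≤ ∫ ξ in Ioi (0 : ℝ), ξ ^ 2 * Real.exp (-(1 * ξ)) :=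
          setIntegral_mono_set (integrableOn_pow_mul_exp_neg_mul one_pos 2)
            (Eventually.of_forall fun ξ => by positivity) (Eventually.of_forall (Ioi_subset_Ioi (by norm_num)))
      _ = 2 := by rw [integral_pow_mul_exp_neg_mul one_pos 2]; simp [Nat.factorial]
  calc ∫ ξ in Ioi (1 : ℝ), |gGauss K ξ| * (1 + Real.cosh ξ) ≤ ∫ ξ in Ioi (1 : ℝ), M ξ := by
        refine setIntegral_mono_on hint hMint measurableSet_Ioi fun ξ hξ => ?_
        have := hle ξ hξ
        rwa [Real.norm_of_nonneg (by positivity)] at this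
    _ = C₀ * ((∫ ξ in Ioi (1 : ℝ), ξ ^ 0 * Real.exp (-(1 * ξ))) + ∫ ξ in Ioi (1 : ℝ), ξ ^ 2 * Real.exp (-(1 * ξ))) := by
        simp only [hM]; rw [integral_const_mul, integral_add hm0 hm2]
    _ ≤ C₀ * (1 + 2) := by gcongr
    _ ≤ _ := by
        have hX : 0 ≤ Real.exp 2 * (π * Real.sqrt π) * K ^ 5 * Real.exp (-(K ^ 2 / 2)) := by positivity
        rw [hC₀]
        nlinarith [hX]

/-! ### The partial integration (5.6) ↔ (5.7): `h_K⁺(x) = 4√πK³ x ∫₀^∞ γ_K sh ξ sin(x ch ξ) dξ` -/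

/-- `γ_K' = (1/2 − ξ²K²) e^{−ξ²K²}`, i.e. `g_K = π√πK³ γ_K'`. [folklore] -/
theorem hasDerivAt_gamK (K ξ : ℝ) :
    HasDerivAt (gamK K) ((1 / 2 - ξ ^ 2 * K ^ 2) * Real.exp (-(ξ ^ 2 * K ^ 2))) ξ := by
  unfold gamK
  have h1 : HasDerivAt (fun ξ : ℝ => ξ / 2) (1 / 2) ξ := by
    simpa using (hasDerivAt_id ξ).div_const 2
  have h2 : HasDerivAt (fun ξ : ℝ => Real.exp (-(ξ ^ 2 * K ^ 2))) (Real.exp (-(ξ ^ 2 * K ^ 2)) * (-(2 * ξ * K ^ 2))) ξ := by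
    have : HasDerivAt (fun ξ : ℝ => -(ξ ^ 2 * K ^ 2)) (-(2 * ξ * K ^ 2)) ξ := by
      have h := ((hasDerivAt_pow 2 ξ).mul_const (K ^ 2)).const_mul (-1 : ℝ)
      simp only [neg_mul, one_mul] at h
      refine (h.congr_deriv ?_)
      simp
    exact this.exp
  refine (h1.mul h2).congr_deriv ?_
  ring

/-- `γ_K ≤ (e^{9/4}/2) ξ e^{−3Kξ}` for `ξ ≥ 0`. [folklore] -/
theorem gamK_le (K : ℝ) {ξ : ℝ} (hξ : 0 ≤ ξ) : gamK K ξ ≤ Real.exp (9 / 4) / 2 * (ξ ^ (1 : ℝ) * Real.exp (-(3 * K) * ξ)) := by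
  rw [Real.rpow_one, gamK, neg_mul]
  have := exp_neg_sq_le K ξ
  calc ξ / 2 * Real.exp (-(ξ ^ 2 * K ^ 2)) ≤ ξ / 2 * (Real.exp (9 / 4) * Real.exp (-(3 * K * ξ))) := by gcongr
    _ = _ := by ring

/-- `γ_K(ξ) → 0` as `ξ → ∞` (`K ≥ 1`). [folklore] -/
theorem tendsto_gamK_atTop {K : ℝ} (hGauss : 1 ≤ K) : Tendsto (gamK K) atTop (𝓝 0) := by
  have h1 : Tendsto (fun ξ : ℝ => Real.exp (9 / 4) / 2 * (ξ ^ (1 : ℝ) * Real.exp (-(3 * K) * ξ))) atTop (𝓝 0) := by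
    have := (tendsto_rpow_mul_exp_neg_mul_atTop_nhds_zero 1 (3 * K) (by linarith)).const_mul (Real.exp (9 / 4) / 2)
    rwa [mul_zero] at this
  refine tendsto_of_tendsto_of_tendsto_of_le_of_le' tendsto_const_nhds h1 ?_ ?_
  · filter_upwards [eventually_ge_atTop 0] with ξ hξ using gamK_nonneg K hξ
  · filter_upwards [eventually_ge_atTop 0] with ξ hξ using gamK_le K hξ

/-- **(5.6) ↔ (5.7)**: `h_K⁺(x) = 4√π K³ x ∫₀^∞ γ_K(ξ) sh ξ sin(x ch ξ) dξ` (partial integration,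
`γ_K(0) = 0`), and the integrand is absolutely integrable. [cite: DeshouillersIwaniec1982, (5.6)–(5.7)] -/
theorem hPlus_eq_formB {K : ℝ} (hGauss : 1 ≤ K) (x : ℝ) :
    IntegrableOn (fun ξ => gamK K ξ * Real.sinh ξ * Real.sin (x * Real.cosh ξ)) (Ioi 0) ∧
      hPlus K x = 4 * Real.sqrt π * K ^ 3 * x * ∫ ξ in Ioi (0 : ℝ), gamK K ξ * Real.sinh ξ * Real.sin (x * Real.cosh ξ) := by
  have hK0 : 0 < K := by linarith
  obtain ⟨hγint, _⟩ := integral_gamK_sinh_le hGauss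
  obtain ⟨hgint, _⟩ := integral_abs_gGauss_le hGauss
  -- the players of the partial integration
  set u : ℝ → ℝ := fun ξ => Real.cos (x * Real.cosh ξ) with hu
  set u' : ℝ → ℝ := fun ξ => -(x * Real.sinh ξ * Real.sin (x * Real.cosh ξ)) with hu'
  set v : ℝ → ℝ := gamK K with hv
  set v' : ℝ → ℝ := fun ξ => (1 / 2 - ξ ^ 2 * K ^ 2) * Real.exp (-(ξ ^ 2 * K ^ 2)) with hv'
  have hdu : ∀ ξ, HasDerivAt u (u' ξ) ξ := by
    intro ξ
    have h := (((Real.hasDerivAt_cosh ξ).const_mul x).cos)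
    simp only [hu, hu']
    refine h.congr_deriv ?_
    ring
  have hdv : ∀ ξ, HasDerivAt v (v' ξ) ξ := fun ξ => hasDerivAt_gamK K ξ
  -- integrability
  have hB : IntegrableOn (fun ξ => gamK K ξ * Real.sinh ξ * Real.sin (x * Real.cosh ξ)) (Ioi 0) := by
    refine Integrable.mono' hγint (by unfold gamK; fun_prop) ((ae_restrict_iff' measurableSet_Ioi).2
      (Eventually.of_forall fun ξ hξ => ?_))
    have h0 : 0 ≤ gamK K ξ * Real.sinh ξ := mul_nonneg (gamK_nonneg K (le_of_lt hξ)) (Real.sinh_nonneg_iff.2 (le_of_lt hξ))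
    rw [Real.norm_eq_abs, abs_mul, abs_of_nonneg h0]
    calc gamK K ξ * Real.sinh ξ * |Real.sin (x * Real.cosh ξ)| ≤ gamK K ξ * Real.sinh ξ * 1 :=
          mul_le_mul_of_nonneg_left (Real.abs_sin_le_one _) h0
      _ ≤ gamK K ξ * Real.sinh ξ * (1 + Real.cosh ξ) := by
          gcongr; linarith [Real.cosh_pos ξ]
  have huv' : IntegrableOn (u * v') (Ioi 0) := by
    have : IntegrableOn (fun ξ => u ξ * v' ξ) (Ioi 0) := by
      refine Integrable.mono' (hgint.norm.const_mul (1 / (π * Real.sqrt π * K ^ 3))) (by simp only [hu, hv']; fun_prop)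
        ((ae_restrict_iff' measurableSet_Ioi).2 (Eventually.of_forall fun ξ _ => ?_))
      rw [norm_mul]
      have hgv : v' ξ = (1 / (π * Real.sqrt π * K ^ 3)) * gGauss K ξ := by
        simp only [hv', gGauss]; field_simp
      calc ‖u ξ‖ * ‖v' ξ‖ ≤ 1 * ‖v' ξ‖ := by
            gcongr; simp only [hu, Real.norm_eq_abs]; exact Real.abs_cos_le_one _
        _ = 1 / (π * Real.sqrt π * K ^ 3) * ‖gGauss K ξ‖ := by
            rw [one_mul, hgv, norm_mul, Real.norm_of_nonneg (by positivity)]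
    exact this
  have hu'v : IntegrableOn (u' * v) (Ioi 0) := by
    have h : IntegrableOn (fun ξ => -x * (gamK K ξ * Real.sinh ξ * Real.sin (x * Real.cosh ξ))) (Ioi 0) := hB.const_mul (-x)
    have : IntegrableOn (fun ξ => u' ξ * v ξ) (Ioi 0) :=
      h.congr_fun (fun ξ _ => by simp only [hu', hv]; ring) measurableSet_Ioi
    exact this
  -- boundary values
  have h_zero : Tendsto (u * v) (𝓝[>] 0) (𝓝 0) := by
    have hc : Continuous (u * v) := by
      have : Continuous fun ξ => u ξ * v ξ := by simp only [hu, hv]; unfold gamK; fun_prop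
      exact this
    have h0 : (u * v) 0 = 0 := by simp [hu, hv, gamK]
    have := (hc.tendsto 0).mono_left (nhdsWithin_le_nhds (s := Ioi 0))
    rwa [h0] at this
  have h_infty : Tendsto (u * v) atTop (𝓝 0) := by
    have hγ := tendsto_gamK_atTop hGauss
    refine squeeze_zero_norm (fun ξ => ?_) (by simpa using hγ.norm)
    simp only [Pi.mul_apply, norm_mul, hu, hv]
    calc ‖Real.cos (x * Real.cosh ξ)‖ * ‖gamK K ξ‖ ≤ 1 * ‖gamK K ξ‖ := by
          gcongr; rw [Real.norm_eq_abs]; exact Real.abs_cos_le_one _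
      _ = ‖gamK K ξ‖ := one_mul _
  have hibp := integral_Ioi_mul_deriv_eq_deriv_mul (fun ξ _ => hdu ξ) (fun ξ _ => hdv ξ) huv' hu'v h_zero h_infty
  -- `∫ u v' = (π√πK³)⁻¹ (π/4) hPlus`, `∫ u' v = −x ∫ γ sh sin`
  refine ⟨hB, ?_⟩
  have h1 : hPlus K x = 4 / π * ((π * Real.sqrt π * K ^ 3) * ∫ ξ in Ioi (0 : ℝ), u ξ * v' ξ) := by
    rw [hPlus]
    congr 1
    rw [← integral_const_mul]
    exact setIntegral_congr_fun measurableSet_Ioi (fun ξ _ => by simp only [hu, hv', gGauss]; ring)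
  have h2 : ∫ ξ in Ioi (0 : ℝ), u' ξ * v ξ = -x * ∫ ξ in Ioi (0 : ℝ), gamK K ξ * Real.sinh ξ * Real.sin (x * Real.cosh ξ) := by
    rw [← integral_const_mul]
    refine setIntegral_congr_fun measurableSet_Ioi fun ξ _ => ?_
    simp only [hu', hv]; ring
  rw [h1, hibp, h2]
  have hπ : π ≠ 0 := Real.pi_ne_zero
  field_simp
  ring

/-- **`|h_K⁺(x)| ≤ 12 e^{9/4} √π K²`** (from `∫|g_K| ≤ 3e^{9/4}π√πK²`). [cite: DeshouillersIwaniec1982, §5.3 p. 260] -/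
theorem abs_hPlus_le_sq {K : ℝ} (hGauss : 1 ≤ K) (x : ℝ) : |hPlus K x| ≤ 12 * Real.exp (9 / 4) * Real.sqrt π * K ^ 2 := by
  obtain ⟨hgint, hgle⟩ := integral_abs_gGauss_le hGauss
  have hπ := Real.pi_pos
  rw [hPlus, abs_mul, abs_of_pos (by positivity : 0 < 4 / π)]
  have h1 : |∫ ξ in Ioi (0 : ℝ), Real.cos (x * Real.cosh ξ) * gGauss K ξ| ≤ ∫ ξ in Ioi (0 : ℝ), |gGauss K ξ| := by
    refine (abs_integral_le_integral_abs).trans (setIntegral_mono_on ?_ hgint.abs measurableSet_Ioi fun ξ _ => ?_)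
    · refine (Integrable.mono' hgint.abs (by unfold gGauss; fun_prop) (Eventually.of_forall fun ξ => ?_)).abs
      rw [Real.norm_eq_abs, abs_mul]
      exact mul_le_of_le_one_left (abs_nonneg _) (Real.abs_cos_le_one _)
    · rw [abs_mul]; exact mul_le_of_le_one_left (abs_nonneg _) (Real.abs_cos_le_one _)
  calc 4 / π * |∫ ξ in Ioi (0 : ℝ), Real.cos (x * Real.cosh ξ) * gGauss K ξ| ≤ 4 / π * (3 * Real.exp (9 / 4) * (π * Real.sqrt π) * K ^ 2) :=
        mul_le_mul_of_nonneg_left (h1.trans hgle) (by positivity)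
    _ = _ := by field_simp; ring

/-- **`|h_K⁺(x)| ≤ 8 e^{9/4} √π |x|`** (from the partial integration and `∫ γ_K sh ≤ 2e^{9/4}K⁻³`).
[cite: DeshouillersIwaniec1982, §5.3 p. 260] -/
theorem abs_hPlus_le_lin {K : ℝ} (hGauss : 1 ≤ K) (x : ℝ) : |hPlus K x| ≤ 8 * Real.exp (9 / 4) * Real.sqrt π * |x| := by
  obtain ⟨hB, heq⟩ := hPlus_eq_formB hGauss x
  obtain ⟨hγint, hγle⟩ := integral_gamK_sinh_le hGauss
  have hK0 : 0 < K := by linarith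
  rw [heq, abs_mul, abs_mul]
  rw [abs_of_pos (by positivity : 0 < 4 * Real.sqrt π * K ^ 3)]
  have h1 : |∫ ξ in Ioi (0 : ℝ), gamK K ξ * Real.sinh ξ * Real.sin (x * Real.cosh ξ)| ≤ 2 * Real.exp (9 / 4) / K ^ 3 := by
    refine (abs_integral_le_integral_abs).trans ((setIntegral_mono_on hB.abs hγint measurableSet_Ioi fun ξ hξ => ?_).trans hγle)
    have h0 : 0 ≤ gamK K ξ * Real.sinh ξ := mul_nonneg (gamK_nonneg K (le_of_lt hξ)) (Real.sinh_nonneg_iff.2 (le_of_lt hξ))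
    rw [abs_mul, abs_of_nonneg h0]
    calc gamK K ξ * Real.sinh ξ * |Real.sin (x * Real.cosh ξ)| ≤ gamK K ξ * Real.sinh ξ * 1 :=
          mul_le_mul_of_nonneg_left (Real.abs_sin_le_one _) h0
      _ ≤ _ := by gcongr; linarith [Real.cosh_pos ξ]
  calc 4 * Real.sqrt π * K ^ 3 * |x| * |∫ ξ in Ioi (0 : ℝ), gamK K ξ * Real.sinh ξ * Real.sin (x * Real.cosh ξ)|
      ≤ 4 * Real.sqrt π * K ^ 3 * |x| * (2 * Real.exp (9 / 4) / K ^ 3) := by gcongr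
    _ = _ := by field_simp; ring

/-! ### The test function on the spectrum -/

/-- `h_K(t) = πt coth(πt) e^{−t²/K²}` for `t ≠ 0`, and `πt coth(πt) ≥ max(1, π|t|)`. [folklore] -/
theorem hGauss_ge_of_ne {K t : ℝ} (ht : t ≠ 0) :
    max 1 (π * |t|) * Real.exp (-(t ^ 2 / K ^ 2)) ≤ hGauss K t := by
  have hπ := Real.pi_pos
  rw [hGauss, if_neg ht]
  refine mul_le_mul_of_nonneg_right ?_ (Real.exp_pos _).le
  -- reduce to `s = π|t| > 0`: `s ch s / sh s ≥ max(1, s)`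
  have key : ∀ s : ℝ, 0 < s → max 1 s ≤ s * Real.cosh s / Real.sinh s := by
    intro s hs
    have hsh : 0 < Real.sinh s := Real.sinh_pos_iff.2 hs
    refine max_le ?_ ?_
    · rw [one_le_div hsh]; exact sinh_le_mul_cosh hs.le
    · rw [le_div_iff₀ hsh]; exact mul_le_mul_of_nonneg_left (Real.sinh_lt_cosh s).le hs.le
  rcases lt_or_gt_of_ne ht with h | h
  · have hs : 0 < π * (-t) := by nlinarith
    have := key _ hs
    rw [abs_of_neg h]
    calc max 1 (π * -t) ≤ π * -t * Real.cosh (π * -t) / Real.sinh (π * -t) := this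
      _ = π * t * Real.cosh (π * t) / Real.sinh (π * t) := by
          rw [show π * -t = -(π * t) by ring, Real.cosh_neg, Real.sinh_neg]; field_simp
  · have hs : 0 < π * t := by positivity
    rw [abs_of_pos h]
    exact key _ hs

/-- **`h_K ≥ 0`** on the real line. [folklore] -/
theorem hGauss_nonneg (K t : ℝ) : 0 ≤ hGauss K t := by
  by_cases ht : t = 0
  · rw [hGauss, if_pos ht]; positivity
  · exact le_trans (by positivity) (hGauss_ge_of_ne (K := K) ht)

/-- **`h_K(t) ≥ e⁻¹ max(1, π|t|)`** for `|t| ≤ K` (`K > 0`). [folklore] -/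
theorem hGauss_ge {K t : ℝ} (hKpos : 0 < K) (ht : |t| ≤ K) : Real.exp (-1) * max 1 (π * |t|) ≤ hGauss K t := by
  have hexp : Real.exp (-1) ≤ Real.exp (-(t ^ 2 / K ^ 2)) := by
    apply Real.exp_le_exp.2
    rw [neg_le_neg_iff, div_le_one (by positivity)]
    calc t ^ 2 = |t| ^ 2 := (sq_abs t).symm
      _ ≤ K ^ 2 := pow_le_pow_left₀ (abs_nonneg t) ht 2
  by_cases h0 : t = 0
  · subst h0
    rw [hGauss, if_pos rfl, abs_zero, mul_zero, max_eq_left (by norm_num), mul_one, one_mul]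
    have h00 : -((0 : ℝ) ^ 2 / K ^ 2) = 0 := by simp
    rw [h00] at hexp ⊢
    exact hexp
  · calc Real.exp (-1) * max 1 (π * |t|) ≤ Real.exp (-(t ^ 2 / K ^ 2)) * max 1 (π * |t|) :=
          mul_le_mul_of_nonneg_right hexp (by positivity)
      _ = max 1 (π * |t|) * Real.exp (-(t ^ 2 / K ^ 2)) := mul_comm _ _
      _ ≤ hGauss K t := hGauss_ge_of_ne h0

/-- **`h_K` is nondecreasing in `K`** (`0 < K ≤ K'`): the device "`K ↦ K₁ > K`" of
[DeshouillersIwaniec1982, p. 261]. [cite: DeshouillersIwaniec1982, §5.3 p. 261] -/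
theorem hGauss_mono {K K' t : ℝ} (hKpos : 0 < K) (hKK : K ≤ K') : hGauss K t ≤ hGauss K' t := by
  unfold hGauss
  refine mul_le_mul_of_nonneg_left (Real.exp_le_exp.2 ?_) ?_
  · rw [neg_le_neg_iff]
    exact div_le_div_of_nonneg_left (sq_nonneg t) (by positivity) (pow_le_pow_left₀ hKpos.le hKK 2)
  · have := hGauss_nonneg K t
    unfold hGauss at this
    exact (mul_nonneg_iff_of_pos_right (Real.exp_pos _)).1 this

/-- **The exceptional spectrum**: `h_K(iy) = πy cot(πy) e^{y²/K²} ≥ cos(πy) ≥ √2/2` for `0 < y ≤ 1/4`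
(`sin(πy) ≤ πy`; Selberg's `λ₁ ≥ 3/16` gives `y ≤ 1/4`). [folklore] -/
theorem hKexc_ge {K y : ℝ} (hy0 : 0 < y) (hy : y ≤ 1 / 4) : Real.sqrt 2 / 2 ≤ hGaussExc K y := by
  have hπ := Real.pi_pos
  have hπy : 0 < π * y := by positivity
  have hπy4 : π * y ≤ π / 4 := by nlinarith
  have hsin : 0 < Real.sin (π * y) := Real.sin_pos_of_pos_of_lt_pi hπy (by nlinarith)
  have hsinle : Real.sin (π * y) ≤ π * y := Real.sin_le hπy.le
  have hcos : Real.sqrt 2 / 2 ≤ Real.cos (π * y) := by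
    rw [← Real.cos_pi_div_four]
    exact Real.cos_le_cos_of_nonneg_of_le_pi hπy.le (by linarith) hπy4
  have hcos0 : 0 ≤ Real.cos (π * y) := le_trans (by positivity) hcos
  have hexp : 1 ≤ Real.exp (y ^ 2 / K ^ 2) := Real.one_le_exp (by positivity)
  unfold hGaussExc
  calc Real.sqrt 2 / 2 ≤ Real.cos (π * y) := hcos
    _ = 1 * Real.cos (π * y) * 1 := by ring
    _ ≤ (π * y / Real.sin (π * y)) * Real.cos (π * y) * Real.exp (y ^ 2 / K ^ 2) := by
        gcongr
        rwa [one_le_div hsin]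
    _ = _ := by ring

/-- **The tail of the partial-integration kernel**: `∫₁^∞ γ_K sh ξ (1 + ch ξ) dξ ≤ 4e^{9/2} e^{−K²/2}`
(`K ≥ 1`). [folklore] -/
theorem integral_gamK_tail_le {K : ℝ} (hGauss : 1 ≤ K) :
    ∫ ξ in Ioi (1 : ℝ), gamK K ξ * Real.sinh ξ * (1 + Real.cosh ξ) ≤ 4 * Real.exp (9 / 2) * Real.exp (-(K ^ 2 / 2)) := by
  obtain ⟨hint, _⟩ := integral_gamK_sinh_le hGauss
  have hint1 : IntegrableOn (fun ξ => gamK K ξ * Real.sinh ξ * (1 + Real.cosh ξ)) (Ioi 1) :=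
    hint.mono_set (Ioi_subset_Ioi (by norm_num))
  have hm2 := (integrableOn_pow_mul_exp_neg_mul one_pos 2).mono_set (Ioi_subset_Ioi (by norm_num : (0 : ℝ) ≤ 1))
  -- pointwise: `γ sh (1 + ch) ≤ e^{9/2} e^{−K²/2} ξ² e^{−ξ}` on `ξ ≥ 1`
  have hle : ∀ ξ ∈ Ioi (1 : ℝ), gamK K ξ * Real.sinh ξ * (1 + Real.cosh ξ) ≤
      Real.exp (9 / 2) * Real.exp (-(K ^ 2 / 2)) * (ξ ^ 2 * Real.exp (-(1 * ξ))) := by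
    intro ξ hξ
    have hξ1 : 1 ≤ ξ := le_of_lt hξ
    have hξ0 : 0 ≤ ξ := by linarith
    have hsh := sinh_le_mul_exp hξ0
    have hsh0 : 0 ≤ Real.sinh ξ := Real.sinh_nonneg_iff.2 hξ0
    have hch : 1 + Real.cosh ξ ≤ 2 * Real.exp ξ := by
      have := cosh_le_exp hξ0; have := Real.one_le_exp hξ0; linarith
    -- `e^{−ξ²K²} ≤ e^{−K²/2} e^{9/2} e^{−3ξ}`
    have hG : Real.exp (-(ξ ^ 2 * K ^ 2)) ≤ Real.exp (-(K ^ 2 / 2)) * (Real.exp (9 / 2) * Real.exp (-(3 * ξ))) := by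
      rw [← Real.exp_add, ← Real.exp_add]
      apply Real.exp_le_exp.2
      have h1 : K ^ 2 / 2 * 1 ≤ K ^ 2 / 2 * ξ ^ 2 := by gcongr; nlinarith
      have h2 : (1 : ℝ) / 2 * ξ ^ 2 ≤ K ^ 2 / 2 * ξ ^ 2 := by gcongr; nlinarith
      nlinarith [sq_nonneg (ξ - 3)]
    have hee : Real.exp (-(3 * ξ)) * Real.exp ξ * Real.exp ξ = Real.exp (-(1 * ξ)) := by
      rw [← Real.exp_add, ← Real.exp_add]; ring_nf
    calc gamK K ξ * Real.sinh ξ * (1 + Real.cosh ξ)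
        ≤ (ξ / 2 * (Real.exp (-(K ^ 2 / 2)) * (Real.exp (9 / 2) * Real.exp (-(3 * ξ))))) * (ξ * Real.exp ξ) * (2 * Real.exp ξ) := by
          unfold gamK
          gcongr
      _ = Real.exp (9 / 2) * Real.exp (-(K ^ 2 / 2)) * (ξ ^ 2 * (Real.exp (-(3 * ξ)) * Real.exp ξ * Real.exp ξ)) := by ring
      _ = _ := by rw [hee]
  have hint2 : ∫ ξ in Ioi (1 : ℝ), ξ ^ 2 * Real.exp (-(1 * ξ)) ≤ 2 := by
    calc ∫ ξ in Ioi (1 : ℝ), ξ ^ 2 * Real.exp (-(1 * ξ)) ≤ ∫ ξ in Ioi (0 : ℝ), ξ ^ 2 * Real.exp (-(1 * ξ)) :=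
          setIntegral_mono_set (integrableOn_pow_mul_exp_neg_mul one_pos 2)
            (Eventually.of_forall fun ξ => by positivity) (Eventually.of_forall (Ioi_subset_Ioi (by norm_num)))
      _ = 2 := by rw [integral_pow_mul_exp_neg_mul one_pos 2]; simp [Nat.factorial]
  calc ∫ ξ in Ioi (1 : ℝ), gamK K ξ * Real.sinh ξ * (1 + Real.cosh ξ)
      ≤ ∫ ξ in Ioi (1 : ℝ), Real.exp (9 / 2) * Real.exp (-(K ^ 2 / 2)) * (ξ ^ 2 * Real.exp (-(1 * ξ))) :=
        setIntegral_mono_on hint1 (hm2.const_mul _) measurableSet_Ioi hle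
    _ = Real.exp (9 / 2) * Real.exp (-(K ^ 2 / 2)) * ∫ ξ in Ioi (1 : ℝ), ξ ^ 2 * Real.exp (-(1 * ξ)) := integral_const_mul _ _
    _ ≤ Real.exp (9 / 2) * Real.exp (-(K ^ 2 / 2)) * 2 := by gcongr
    _ ≤ _ := by nlinarith [Real.exp_pos (9 / 2), Real.exp_pos (-(K ^ 2 / 2)), mul_pos (Real.exp_pos (9 / 2)) (Real.exp_pos (-(K ^ 2 / 2)))]

end DeshouillersIwaniec

end Literature.NumberTheory.Sieve
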